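import Literature.GroupTheory.ProP.OperatorFrattiniOpen
import Literature.GroupTheory.Nilpotent.NormalGeneratorsConjRel
import HarnessLib

/-!
# A normal pro-`p` subgroup with `(p'‑procyclic)`-by-procyclic quotient is topologically normally
# finitely generated

U. Jannsen, K. Wingberg, *Die Struktur der absoluten Galoisgruppe `p`-adischer Zahlkörper*, Invent.
Math. 70 (1982), §1, and J. Neukirch, A. Schmidt, K. Wingberg, *Cohomology of Number Fields*, Thm.
7.5.3 / §7.5: the wild inertia group `P = V_k` of a `p`-adic field is finitely generated as a closed
normal subgroup of `G_k`; the tame quotient `G_k / V_k` is generated by `σ, τ` with `σ τ σ⁻¹ = τ^q`.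
This file isolates the GROUP-THEORETIC mechanism.  Let `G` be a profinite group topologically
generated by `g₁, …, g_d`, `P ⊴ G` a closed normal pro-`p` subgroup contained in a subgroup `I`, and
`s ∈ G`, `q = p ^ f`, such that

* `s t s⁻¹ t^{-q} ∈ P` for every `t ∈ I` (Frobenius acts on tame inertia by `u ↦ u^q`);
* every finite continuous quotient of `G` is `⟨s̄⟩ · Ī` (the quotient by inertia is pro-cyclic on `s`);
* in every finite continuous quotient `G ⧸ U` with `P ≤ U`, the image of `I` is cyclic of order
  prime to `p` (tame inertia is pro-cyclic and pro-prime-to-`p`).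

Then:

* `exists_normalClosure_map_eq_of_conj_rel` — in every finite continuous quotient `G ⧸ U` the image
  of `P` is the normal closure of `d + 2` of its elements (the finite lemma
  `Literature.GroupTheory.exists_normalClosure_eq_of_conj_rel`);
* `exists_topologicalClosure_normalClosure_eq` — by compactness, `P` is the topological normal
  closure of `d + 2` of its elements.

Combined with `Literature/GroupTheory/ProP/OperatorFrattiniOpen.lean` this shows that every abstract
homomorphism from `G` to an elementary abelian `p`-group is continuous on `P`, WITHOUT `P` being
topologically finitely generated.  Proof-only (no definitions); Mathlib + tree files.
[cite: JannsenWingberg1982, §1] [cite: NeukirchSchmidtWingberg2008, Thm. 7.5.3]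
-/

namespace Literature.GroupTheory.ProP

open Subgroup Topology
open scoped Pointwise

universe u

variable {G : Type u} [Group G] [TopologicalSpace G] [IsTopologicalGroup G] [CompactSpace G]
  [TotallyDisconnectedSpace G]

/-! ### The finite levels -/

omit [TotallyDisconnectedSpace G] in
/-- **Finite level.**  Under the hypotheses described in the module docstring, in every finite
continuous quotient `G ⧸ U` (`U` open normal) the image of `P` is the normal closure of `d + 2` of
its elements. [cite: JannsenWingberg1982, §1] [cite: NeukirchSchmidtWingberg2008, Thm. 7.5.3] -/
theorem exists_normalClosure_map_eq_of_conj_rel {p : ℕ} [hp : Fact p.Prime]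
    {P : Subgroup G} [P.Normal]
    (hP : ∀ x ∈ P, ∀ U : Subgroup G, IsOpen (U : Set G) → ∃ a : ℕ, x ^ (p ^ a) ∈ U)
    {d : ℕ} {g : Fin d → G} (hg : (Subgroup.closure (Set.range g)).topologicalClosure = ⊤)
    {I : Subgroup G} {s : G} {f : ℕ}
    (hrel : ∀ t ∈ I, s * t * s⁻¹ * (t ^ (p ^ f))⁻¹ ∈ P)
    (hGI : ∀ U : OpenNormalSubgroup G, ∀ x : G, ∃ (n : ℤ) (ι : G), ι ∈ I ∧
      QuotientGroup.mk' U.toSubgroup x = QuotientGroup.mk' U.toSubgroup s ^ n * QuotientGroup.mk' U.toSubgroup ι)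
    (hI : ∀ U : OpenNormalSubgroup G, P ≤ U.toSubgroup →
      IsCyclic (I.map (QuotientGroup.mk' U.toSubgroup)) ∧
        (Nat.card (I.map (QuotientGroup.mk' U.toSubgroup))).Coprime p)
    (U : OpenNormalSubgroup G) :
    ∃ y : Fin (d + 2) → G ⧸ U.toSubgroup, (∀ a, y a ∈ P.map (QuotientGroup.mk' U.toSubgroup)) ∧
      Subgroup.normalClosure (Set.range y) = P.map (QuotientGroup.mk' U.toSubgroup) := by
  classical
  haveI : Finite (G ⧸ U.toSubgroup) := Subgroup.quotient_finite_of_isOpen U.toSubgroup U.isOpen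
  set πU := QuotientGroup.mk' U.toSubgroup with hπU
  set Pbar : Subgroup (G ⧸ U.toSubgroup) := P.map πU with hPbar
  haveI : Pbar.Normal := Subgroup.Normal.map inferInstance _ (QuotientGroup.mk'_surjective _)
  have hPbarp : IsPGroup p Pbar := isPGroup_map_mk hP U.toSubgroup U.isOpen
  have hgen := closure_range_mk_comp_eq_top hg U.toSubgroup U.isOpen
  -- the open normal subgroup `V = U P`
  let V : OpenNormalSubgroup G :=
    { toOpenSubgroup := ⟨U.toSubgroup ⊔ P, Subgroup.isOpen_mono le_sup_left U.isOpen⟩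
      isNormal' := Subgroup.sup_normal U.toSubgroup P }
  have hVsub : V.toSubgroup = U.toSubgroup ⊔ P := rfl
  set πV := QuotientGroup.mk' V.toSubgroup with hπV
  obtain ⟨hcyc, hcop⟩ := hI V (by rw [hVsub]; exact le_sup_right)
  -- a generator `πV t₁` of the image of `I` in `G ⧸ V`, `t₁ ∈ I`, of order `m` prime to `p`
  obtain ⟨γ, hγ⟩ := @IsCyclic.exists_generator _ _ hcyc
  obtain ⟨t₁, ht₁I, ht₁γ⟩ := Subgroup.mem_map.mp γ.2
  set m := Nat.card (I.map πV) with hm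
  have hγm : (γ : G ⧸ V.toSubgroup) ^ m = 1 := by
    have h1 : γ ^ m = 1 := pow_card_eq_one'
    simpa using congrArg Subtype.val h1
  -- `πU (t₁ ^ m) ∈ Pbar`
  have hmem_of_V : ∀ z : G, z ∈ V.toSubgroup → πU z ∈ Pbar := by
    intro z hz
    rw [hVsub] at hz
    obtain ⟨u, hu, c, hc, rfl⟩ := Subgroup.mem_sup_of_normal_right.mp hz
    rw [map_mul, show πU u = 1 from (QuotientGroup.eq_one_iff u).mpr hu, one_mul]
    exact Subgroup.mem_map_of_mem _ hc
  have ht₁m : πU (t₁ ^ m) ∈ Pbar := by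
    apply hmem_of_V
    rw [← QuotientGroup.eq_one_iff, ← QuotientGroup.mk'_apply, ← hπV, map_pow, ht₁γ, hγm]
  -- kill the `p`-part: `t = πU t₁ ^ (p ^ b)` has order dividing `m`
  obtain ⟨b, hb⟩ := hPbarp ⟨πU (t₁ ^ m), ht₁m⟩
  have hb' : πU t₁ ^ (m * p ^ b) = 1 := by
    have := congrArg Subtype.val hb
    simpa [pow_mul] using this
  set t : G ⧸ U.toSubgroup := πU t₁ ^ (p ^ b) with ht
  have htm : t ^ m = 1 := by rw [ht, ← pow_mul, mul_comm, hb']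
  have hordt : (orderOf t).Coprime p :=
    Nat.Coprime.coprime_dvd_left (orderOf_dvd_of_pow_eq_one htm) hcop
  -- the relation
  have hrel' : πU s * t * (πU s)⁻¹ * (t ^ (p ^ f))⁻¹ ∈ Pbar := by
    have h1 := hrel (t₁ ^ (p ^ b)) (pow_mem ht₁I _)
    have : πU s * t * (πU s)⁻¹ * (t ^ (p ^ f))⁻¹ = πU (s * t₁ ^ (p ^ b) * s⁻¹ * ((t₁ ^ (p ^ b)) ^ (p ^ f))⁻¹) := by
      rw [ht]; simp only [map_mul, map_inv, map_pow]
    rw [this]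
    exact Subgroup.mem_map_of_mem _ h1
  -- generation: `⟨πU s, t⟩ ⊔ Pbar = ⊤`
  have hcopb : (p ^ b).Coprime (orderOf (γ : G ⧸ V.toSubgroup)) :=
    (Nat.Coprime.coprime_dvd_left (orderOf_dvd_of_pow_eq_one hγm) hcop).pow_right b |>.symm
  obtain ⟨e, he⟩ := exists_pow_eq_self_of_coprime hcopb
  have hIle : ∀ ι ∈ I, πU ι ∈ Subgroup.zpowers t ⊔ Pbar := by
    intro ι hι
    obtain ⟨k, hk⟩ := Subgroup.mem_zpowers_iff.mp (hγ ⟨πV ι, Subgroup.mem_map_of_mem _ hι⟩)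
    have hk' : (γ : G ⧸ V.toSubgroup) ^ k = πV ι := by
      simpa using congrArg Subtype.val hk
    set r : ℤ := (e : ℤ) * k with hr
    have h1 : πV ((t₁ ^ (p ^ b)) ^ r) = πV ι := by
      rw [map_zpow, map_pow, ht₁γ, hr, zpow_mul, zpow_natCast, he, hk']
    have hmemV : ι * ((t₁ ^ (p ^ b)) ^ r)⁻¹ ∈ V.toSubgroup := by
      rw [← QuotientGroup.eq_one_iff, ← QuotientGroup.mk'_apply, ← hπV, map_mul, map_inv, h1,
        mul_inv_cancel]
    have hP' := hmem_of_V _ hmemV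
    have hι_eq : πU ι = πU (ι * ((t₁ ^ (p ^ b)) ^ r)⁻¹) * t ^ r := by
      rw [ht, map_mul, map_inv, map_zpow, map_pow, inv_mul_cancel_right]
    rw [hι_eq, sup_comm]
    exact Subgroup.mul_mem_sup hP' (Subgroup.zpow_mem _ (Subgroup.mem_zpowers t) r)
  have hgen' : Subgroup.closure ({πU s, t} : Set (G ⧸ U.toSubgroup)) ⊔ Pbar = ⊤ := by
    rw [eq_top_iff]
    rintro x -
    obtain ⟨x, rfl⟩ := QuotientGroup.mk'_surjective U.toSubgroup x
    obtain ⟨n, ι, hι, hx⟩ := hGI U x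
    rw [← hπU] at hx ⊢
    rw [hx]
    set C : Subgroup (G ⧸ U.toSubgroup) := Subgroup.closure ({πU s, t} : Set (G ⧸ U.toSubgroup)) with hC
    have hsC : πU s ∈ C := Subgroup.subset_closure (Set.mem_insert (πU s) {t})
    have htC : t ∈ C := Subgroup.subset_closure (Set.mem_insert_of_mem (πU s) (Set.mem_singleton t))
    have h1 : πU s ^ n ∈ C ⊔ Pbar := Subgroup.mem_sup_left (Subgroup.zpow_mem C hsC n)
    have htle : Subgroup.zpowers t ≤ C := (Subgroup.zpowers_le).mpr htC
    have hsub : Subgroup.zpowers t ⊔ Pbar ≤ C ⊔ Pbar := sup_le_sup_right htle Pbar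
    exact mul_mem h1 (hsub (hIle ι hι))
  exact Literature.GroupTheory.exists_normalClosure_eq_of_conj_rel (p := p) hgen hPbarp hordt hrel' hgen'

/-! ### Compactness -/

omit [TopologicalSpace G] [IsTopologicalGroup G] [CompactSpace G] [TotallyDisconnectedSpace G] in
/-- Monotonicity of the finite-level statement: if the images of `y` normally generate the image of
`P` in `G ⧸ U'`, they do so in every coarser quotient `G ⧸ U`, `U' ≤ U`.
[cite: JannsenWingberg1982, §1] -/
theorem normalClosure_map_eq_of_le {P : Subgroup G} {n : ℕ} (y : Fin n → G)
    {U' U : Subgroup G} [U'.Normal] [U.Normal] (hle : U' ≤ U)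
    (h : Subgroup.normalClosure (Set.range fun a => (QuotientGroup.mk (y a) : G ⧸ U')) =
      P.map (QuotientGroup.mk' U')) :
    Subgroup.normalClosure (Set.range fun a => (QuotientGroup.mk (y a) : G ⧸ U)) =
      P.map (QuotientGroup.mk' U) := by
  set φ : G ⧸ U' →* G ⧸ U := QuotientGroup.map U' U (MonoidHom.id G) (by
    intro x hx; exact hle hx) with hφ
  have hφmk : ∀ x : G, φ (QuotientGroup.mk x) = QuotientGroup.mk x := fun x => by
    rw [hφ, QuotientGroup.map_mk, MonoidHom.id_apply]
  have hφsurj : Function.Surjective φ := by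
    intro q
    obtain ⟨x, rfl⟩ := QuotientGroup.mk_surjective q
    exact ⟨QuotientGroup.mk x, hφmk x⟩
  have hcomp : φ.comp (QuotientGroup.mk' U') = QuotientGroup.mk' U := by
    ext x; exact hφmk x
  have := congrArg (Subgroup.map φ) h
  rw [Subgroup.map_normalClosure _ _ hφsurj, Subgroup.map_map, hcomp, ← Set.range_comp] at this
  convert this using 3
  ext a
  exact (hφmk (y a)).symm

/-- **A normal pro-`p` subgroup with `(p'‑procyclic)`-by-procyclic quotient data is topologically
normally finitely generated.**  Let `G` be profinite, topologically generated by `g₁, …, g_d`;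
`P ⊴ G` closed, pro-`p`, contained in a subgroup `I`; `s ∈ G` with `s t s⁻¹ t^{-p^f} ∈ P` for all
`t ∈ I`; every finite continuous quotient of `G` equal to `⟨s̄⟩ Ī`; and the image of `I` in every
finite continuous quotient `G ⧸ U` with `P ≤ U` cyclic of order prime to `p`.  Then `P` is the
topological normal closure of `d + 2` of its elements.
[cite: JannsenWingberg1982, §1] [cite: NeukirchSchmidtWingberg2008, Thm. 7.5.3] -/
theorem exists_topologicalClosure_normalClosure_eq {p : ℕ} [hp : Fact p.Prime]
    {P : Subgroup G} [P.Normal] (hPc : IsClosed (P : Set G))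
    (hP : ∀ x ∈ P, ∀ U : Subgroup G, IsOpen (U : Set G) → ∃ a : ℕ, x ^ (p ^ a) ∈ U)
    {d : ℕ} {g : Fin d → G} (hg : (Subgroup.closure (Set.range g)).topologicalClosure = ⊤)
    {I : Subgroup G} {s : G} {f : ℕ}
    (hrel : ∀ t ∈ I, s * t * s⁻¹ * (t ^ (p ^ f))⁻¹ ∈ P)
    (hGI : ∀ U : OpenNormalSubgroup G, ∀ x : G, ∃ (n : ℤ) (ι : G), ι ∈ I ∧
      QuotientGroup.mk' U.toSubgroup x = QuotientGroup.mk' U.toSubgroup s ^ n * QuotientGroup.mk' U.toSubgroup ι)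
    (hI : ∀ U : OpenNormalSubgroup G, P ≤ U.toSubgroup →
      IsCyclic (I.map (QuotientGroup.mk' U.toSubgroup)) ∧
        (Nat.card (I.map (QuotientGroup.mk' U.toSubgroup))).Coprime p) :
    ∃ y : Fin (d + 2) → G, (∀ a, y a ∈ P) ∧
      (Subgroup.normalClosure (Set.range y)).topologicalClosure = P := by
  classical
  haveI : CompactSpace P := isCompact_iff_compactSpace.mp hPc.isCompact
  -- the compact sets `X U` of lifts of normal generators at level `U`
  let X : OpenNormalSubgroup G → Set (Fin (d + 2) → P) := fun U =>
    {y | Subgroup.normalClosure (Set.range fun a => (QuotientGroup.mk ((y a : P) : G) : G ⧸ U.toSubgroup)) =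
      P.map (QuotientGroup.mk' U.toSubgroup)}
  have hXne : ∀ U, (X U).Nonempty := by
    intro U
    obtain ⟨ybar, hybar, hgen⟩ := exists_normalClosure_map_eq_of_conj_rel hP hg hrel hGI hI U
    have hlift : ∀ a, ∃ x : P, (QuotientGroup.mk (x : G) : G ⧸ U.toSubgroup) = ybar a := by
      intro a
      obtain ⟨x, hx, hxy⟩ := Subgroup.mem_map.mp (hybar a)
      exact ⟨⟨x, hx⟩, hxy⟩
    choose y hy using hlift
    refine ⟨y, ?_⟩
    show Subgroup.normalClosure _ = _
    have : (fun a => (QuotientGroup.mk ((y a : P) : G) : G ⧸ U.toSubgroup)) = ybar := funext hy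
    rw [this, hgen]
  have hXclosed : ∀ U, IsClosed (X U) := by
    intro U
    haveI : DiscreteTopology (G ⧸ U.toSubgroup) := QuotientGroup.discreteTopology U.isOpen
    have hcont : Continuous fun (y : Fin (d + 2) → P) (a : Fin (d + 2)) =>
        (QuotientGroup.mk ((y a : P) : G) : G ⧸ U.toSubgroup) := by
      refine continuous_pi fun a => ?_
      exact (continuous_quotient_mk'.comp continuous_subtype_val).comp (continuous_apply a)
    have hXU : X U = (fun (y : Fin (d + 2) → P) (a : Fin (d + 2)) =>
        (QuotientGroup.mk ((y a : P) : G) : G ⧸ U.toSubgroup)) ⁻¹'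
        {ybar | Subgroup.normalClosure (Set.range ybar) = P.map (QuotientGroup.mk' U.toSubgroup)} := rfl
    rw [hXU]
    exact (isClosed_discrete _).preimage hcont
  have hXdir : Directed (· ⊇ ·) X := by
    intro U₁ U₂
    refine ⟨U₁ ⊓ U₂, fun y hy => ?_, fun y hy => ?_⟩
    · exact normalClosure_map_eq_of_le (P := P) (fun a => ((y a : P) : G))
        (U' := (U₁ ⊓ U₂).toSubgroup) (U := U₁.toSubgroup) inf_le_left hy
    · exact normalClosure_map_eq_of_le (P := P) (fun a => ((y a : P) : G))
        (U' := (U₁ ⊓ U₂).toSubgroup) (U := U₂.toSubgroup) inf_le_right hy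
  haveI : Nonempty (OpenNormalSubgroup G) :=
    ⟨⟨⊤, by change (⊤ : Subgroup G).Normal; infer_instance⟩⟩
  obtain ⟨y, hy⟩ := IsCompact.nonempty_iInter_of_directed_nonempty_isCompact_isClosed X hXdir hXne
    (fun U => (hXclosed U).isCompact) hXclosed
  refine ⟨fun a => (y a : G), fun a => (y a).2, ?_⟩
  set N : Subgroup G := Subgroup.normalClosure (Set.range fun a => ((y a : P) : G)) with hN
  have hNP : N ≤ P := Subgroup.normalClosure_le_normal (by rintro _ ⟨a, rfl⟩; exact (y a).2)
  apply le_antisymm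
  · exact N.topologicalClosure_minimal hNP hPc
  · intro x hx
    -- every open coset `x • U` meets `N`
    by_contra hnot
    have hV : IsOpen ((fun z => x * z) ⁻¹' ((N.topologicalClosure : Set G)ᶜ)) :=
      (Subgroup.isClosed_topologicalClosure N).isOpen_compl.preimage (by fun_prop)
    obtain ⟨U, hU⟩ := ProfiniteGrp.exist_openNormalSubgroup_sub_open_nhds_of_one hV
      (by simpa only [Set.mem_preimage, mul_one, Set.mem_compl_iff, SetLike.mem_coe] using hnot)
    have hyU : y ∈ X U := Set.mem_iInter.mp hy U
    have hxU : (QuotientGroup.mk x : G ⧸ U.toSubgroup) ∈ P.map (QuotientGroup.mk' U.toSubgroup) :=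
      Subgroup.mem_map_of_mem _ hx
    change Subgroup.normalClosure _ = _ at hyU
    rw [← hyU] at hxU
    -- the normal closure at level `U` is the image of `N`
    have himg : Subgroup.normalClosure (Set.range fun a => (QuotientGroup.mk ((y a : P) : G) : G ⧸ U.toSubgroup))
        = N.map (QuotientGroup.mk' U.toSubgroup) := by
      rw [hN, Subgroup.map_normalClosure _ _ (QuotientGroup.mk'_surjective _), ← Set.range_comp]
      rfl
    rw [himg] at hxU
    obtain ⟨z, hz, hzx⟩ := Subgroup.mem_map.mp hxU
    rw [QuotientGroup.mk'_apply, QuotientGroup.eq] at hzx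
    -- `x * (x⁻¹ z)⁻¹ ...`: the element `z = x (x⁻¹ z)` lies in `x • U` and in `N`
    have h1 : x⁻¹ * z ∈ (U : Set G) := by
      have h2 : z⁻¹ * x ∈ U.toSubgroup := hzx
      have h3 := U.toSubgroup.inv_mem h2
      rw [mul_inv_rev, inv_inv] at h3
      exact h3
    have := hU h1
    simp only [Set.mem_preimage, mul_inv_cancel_left, Set.mem_compl_iff] at this
    exact this (Subgroup.le_topologicalClosure N hz)

end Literature.GroupTheory.ProP
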